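import Mathlib
import Summits.KontsevichZagierPeriods.Zeta5Search.ClassExpBoundProof
import HarnessLib

/-!
# ζ(5) search — the floor inequality (T1-v) for `U` is a THEOREM

Cell `pub-zeta5` (HONEST FRAMING: systematic search; no irrationality claim unless certified), typer seat
generation 8.  Discharges BY NAME `ClusterValuation.FloorInequalityU` (gen-2 g7, REPORT-gen2-g7 §1 (T1-v)): in the window
`5 ≤ p ≤ b₀ < p² − 2`, `law_U = min(1,⌊d/p⌋) − 1 − N_p ≤ T_x(5)` for EVERY class `x`.

PROOF.  For a class with at most one pole `T_x(5) = max(5 + E_x, 0) ≥ 0 ≥ law_U` (`lawUNonpos_holds`); for a class with at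
least two poles Lemma V1 (`classExpLowerBound_holds`: `E_x ≥ −N_p − 1`) gives `T_x(5) ≥ 5 + E_x ≥ 4 − N_p ≥ law_U` (the
palindrome bonus is non-negative and the refund is `≤ 1`) — as gen-2 g7 remarked, with room `≥ 2` to spare.
Integer bookkeeping; nothing about irrationality.
-/

noncomputable section

open Finset

namespace Summit.KontsevichZagierPeriods.Zeta5Search.ClusterValuation

open Summit.KontsevichZagierPeriods.Zeta5Search.CasoratianValuation (InPolytope pairFloors refund)

/-- **(T1-v) is a theorem**: `law_U ≤ T_x(5)` for every class in the window. -/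
theorem floorInequalityU_holds : FloorInequalityU := by
  intro b p x hb hp5 hodd hpb hwin hx
  have hU : lawU b p ≤ 0 := lawUNonpos_holds b p hb hp5
  have hr : refund b p ≤ 1 := min_le_left _ _
  unfold classBound
  split_ifs with hmulti hpal
  · have hV1 := classExpLowerBound_holds b p x hb hp5 hodd hpb hwin hx hmulti
    unfold lawU; push_cast; linarith
  · have hV1 := classExpLowerBound_holds b p x hb hp5 hodd hpb hwin hx hmulti
    unfold lawU; push_cast; linarith
  · exact hU.trans (le_max_right _ _)

end Summit.KontsevichZagierPeriods.Zeta5Search.ClusterValuation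

end
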